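import Summits.NavierStokesRegularity.NavierStokesRegularity.Theorems.MustSqueeze.Negative.WithoutOseen
import Literature.Analysis.FluidPDE.HyperbolicDSSOrbit
import Mathlib.Analysis.InnerProductSpace.Laplacian
import Mathlib.Analysis.Calculus.Gradient.Basic

/-!
# Linear Leray profiles: exact squeezed self-similar Navier–Stokes flows outside `𝒦_C`

Negative-side support for crux `MustSqueeze` (stmt-NavierStokesRegularity-11610), cdisprove gen 4.

The two-parameter linear field `linA μ b y = (−μy₀ + b y₁, −b y₀ − μ y₁, 2μ y₂)` (axisymmetric
strain `diag(−μ, −μ, 2μ)` plus rotation of rate `b` about the axis `e₂`) is an EXACT profile of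
Leray's backward self-similar system `−νΔU + ½U + ½(y·∇)U + (U·∇)U + ∇P = 0`, `div U = 0`
(tree `IsLerayProfile ν (1/2)`), for every viscosity `ν` (it is harmonic), exactly when
`b(1 − 2μ) = 0` (`isLerayProfile_linA`): the pure strains (`b = 0`, any `μ`) and the
**stretched similarity column** (`μ = ½`, any swirl `b`), whose similarity vorticity
`curl U = −2b e₂` is STATIONARY — stretching `(Ω·∇)U = Ω` exactly balances Leray's damping.
The physical field is Leray's ansatz `u(t,x) = (−t)⁻¹ linA μ b x` (`lin_eq_lerayBackward`), an
exact ancient Navier–Stokes flow, smooth and divergence free on `t < 0` (H1, H2), squeezed with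
`Λ ≡ λ₂(sym ∇U) = −μ` — ANY real threshold, arbitrarily negative (`lin_h6`) — and it is not
Type-I bounded (`lin_not_h4`; it also violates H5 and the typed Oseen clause H3).

Consequences recorded here:
* `not_mustSqueezeProfiles`: the self-similar shadow of the crux WITHOUT normalisation — "every
  Leray profile squeezed below `a` vanishes" — is false for every `a : ℝ`.  In the self-similar
  sector the squeeze has no force of its own; NRŠ 1996 / Tsai 1998 kill profiles through
  `U ∈ L³` / local energy bounds, i.e. through H4–H5, whatever `Λ` is.
* For the picked line (outward-drift-signed-flux): on the column, `Z_R(s) = ∫φ_R|Ω|² = 4b²∫φ_R`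
  is a nonzero constant in `s` although `λ₂ = −½ < 0`; the lever's budget
  `Z_R' ≤ −2(¼ − a)Z_R + K_R`, `K_R ≤ κ(E(2R)/R + √(E(2R)/R))`, would be violated for large `R`
  (`Z_R ∼ R³` against `E(2R)/R ∼ R²`): what fails is `‖U‖_∞ ≤ C` — the transport flux
  `½∫|Ω|²(U·∇φ_R)` and the cubic flux `4∫(U₁∇U₂×∇U₃)·∇φ_R` are of leading order `R³` when
  `|U| ∼ R`.  So the dependence of `κ` on `C = ‖U‖_∞` (H4 in similarity variables) is exactly
  where the normalisation enters the lever; production here is `Ω·SΩ = +|Ω|²` (all from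
  `λ₁ = 1 ∥ Ω`), the dynamic version of `not_pointwise_surrogate`.
-/

noncomputable section

namespace Summit.NavierStokesRegularity.NavierStokesRegularity.Theorems.MustSqueeze.Negative

open MeasureTheory Set Filter Topology
open Literature.Analysis.FluidPDE
open scoped RealInnerProductSpace Laplacian

/-- Physical / similarity space `ℝ³`. -/
local notation "ℝ³" => EuclideanSpace ℝ (Fin 3)

/-- `e₂`, the stretching axis. -/
def e2 : ℝ³ := EuclideanSpace.single 2 1

/-- The linear profile `linA μ b y = (−μy₀ + b y₁, −b y₀ − μ y₁, 2μ y₂)`. -/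
def linA (μ b : ℝ) : ℝ³ →L[ℝ] ℝ³ :=
  (-μ) • ((EuclideanSpace.proj (0 : Fin 3) : ℝ³ →L[ℝ] ℝ).smulRight e0 +
      (EuclideanSpace.proj (1 : Fin 3) : ℝ³ →L[ℝ] ℝ).smulRight e1) +
    (2 * μ) • (EuclideanSpace.proj (2 : Fin 3) : ℝ³ →L[ℝ] ℝ).smulRight e2 - b • rot

/-- Unfolding `linA` (definitional). -/
theorem linA_apply (μ b : ℝ) (y : ℝ³) :
    linA μ b y = (-μ) • (y 0 • e0 + y 1 • e1) + (2 * μ) • (y 2 • e2) - b • rot y := rfl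

/-- First coordinate of `linA μ b y`: `−μ y₀ + b y₁`. -/
theorem linA_fst (μ b : ℝ) (y : ℝ³) : linA μ b y 0 = -μ * y 0 + b * y 1 := by
  have h := rot_coord y
  simp [linA_apply, e0, e1, e2, h.1]

/-- Second coordinate of `linA μ b y`: `−b y₀ − μ y₁`. -/
theorem linA_snd (μ b : ℝ) (y : ℝ³) : linA μ b y 1 = -b * y 0 - μ * y 1 := by
  have h := rot_coord y
  simp [linA_apply, e0, e1, e2, h.2.1]
  ring

/-- Third coordinate of `linA μ b y`: `2μ y₂`. -/
theorem linA_thd (μ b : ℝ) (y : ℝ³) : linA μ b y 2 = 2 * μ * y 2 := by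
  have h := rot_coord y
  simp [linA_apply, e0, e1, e2, h.2.2]

/-- The linear profile is divergence free (`tr = −μ − μ + 2μ = 0`). -/
theorem linA_divFree (μ b : ℝ) : VectorCalculus.IsDivFree (⇑(linA μ b)) := by
  intro y
  rw [divergence_eq_sum_inner_fderiv (EuclideanSpace.basisFun (Fin 3) ℝ), (linA μ b).fderiv,
    Fin.sum_univ_three]
  simp only [EuclideanSpace.basisFun_apply, EuclideanSpace.inner_single_left, map_one, one_mul,
    linA_fst, linA_snd, linA_thd]
  simp
  ring

/-- Its vorticity is the constant vector `−2b e₂` (pure swirl about the axis). -/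
theorem curl_linA (μ b : ℝ) (y : ℝ³) : curl (⇑(linA μ b)) y = (-2 * b) • e2 := by
  have hD : fderiv ℝ (⇑(linA μ b)) y = linA μ b := (linA μ b).fderiv
  ext i
  fin_cases i
  · simp [curl, hD, linA_fst, linA_snd, linA_thd, e2]
  · simp [curl, hD, linA_fst, linA_snd, linA_thd, e2]
  · simp [curl, hD, linA_fst, linA_snd, linA_thd, e2]
    ring

/-- The axis is an eigenvector with eigenvalue `2μ`: `(Ω·∇)U = 2μ Ω` for `Ω ∥ e₂`. -/
theorem linA_e2 (μ b : ℝ) : linA μ b e2 = (2 * μ) • e2 := by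
  ext i
  fin_cases i
  · simp [linA_fst, e2]
  · simp [linA_snd, e2]
  · simp [linA_thd, e2]

/-- The quadratic form on the plane `e₀, e₁` is `−μ|ξ|²` (the squeezed plane; `λ₂(sym) = −μ`
for `μ ≥ −2μ`, i.e. `μ ≥ 0`, and in any case the Courant–Fischer clause H6 holds with `a = −μ`). -/
theorem inner_linA_plane (μ b α β : ℝ) :
    ⟪linA μ b (α • e0 + β • e1), α • e0 + β • e1⟫ = -μ * (α ^ 2 + β ^ 2) := by
  rw [real_inner_fin_three, linA_fst, linA_snd, linA_thd]
  simp [e0, e1]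
  ring

/-! ### The pressure and Leray's profile system -/

/-- The (diagonal) pressure Hessian `−∇²P = diag(μ² − μ − b², μ² − μ − b², 2μ + 4μ²)`. -/
def linQ (μ b : ℝ) : ℝ³ →L[ℝ] ℝ³ :=
  (μ ^ 2 - μ - b ^ 2) • ((EuclideanSpace.proj (0 : Fin 3) : ℝ³ →L[ℝ] ℝ).smulRight e0 +
      (EuclideanSpace.proj (1 : Fin 3) : ℝ³ →L[ℝ] ℝ).smulRight e1) +
    (2 * μ + 4 * μ ^ 2) • (EuclideanSpace.proj (2 : Fin 3) : ℝ³ →L[ℝ] ℝ).smulRight e2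

/-- Unfolding `linQ` (definitional). -/
theorem linQ_apply (μ b : ℝ) (y : ℝ³) :
    linQ μ b y = (μ ^ 2 - μ - b ^ 2) • (y 0 • e0 + y 1 • e1) + (2 * μ + 4 * μ ^ 2) • (y 2 • e2) := rfl

/-- First coordinate of `linQ μ b y`. -/
theorem linQ_fst (μ b : ℝ) (y : ℝ³) : linQ μ b y 0 = (μ ^ 2 - μ - b ^ 2) * y 0 := by
  simp [linQ_apply, e0, e1, e2]

/-- Second coordinate of `linQ μ b y`. -/
theorem linQ_snd (μ b : ℝ) (y : ℝ³) : linQ μ b y 1 = (μ ^ 2 - μ - b ^ 2) * y 1 := by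
  simp [linQ_apply, e0, e1, e2]

/-- Third coordinate of `linQ μ b y`. -/
theorem linQ_thd (μ b : ℝ) (y : ℝ³) : linQ μ b y 2 = (2 * μ + 4 * μ ^ 2) * y 2 := by
  simp [linQ_apply, e0, e1, e2]

/-- `linQ` is symmetric (it is diagonal). -/
theorem linQ_symm (μ b : ℝ) (x y : ℝ³) : ⟪linQ μ b x, y⟫ = ⟪x, linQ μ b y⟫ := by
  rw [real_inner_fin_three, real_inner_fin_three, linQ_fst, linQ_snd, linQ_thd, linQ_fst, linQ_snd,
    linQ_thd]
  ring

/-- The pressure profile `P(y) = −½⟪Q y, y⟫`. -/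
def linP (μ b : ℝ) (y : ℝ³) : ℝ := -(1 / 2 : ℝ) * ⟪linQ μ b y, y⟫

/-- Gradient of a symmetric quadratic form: `∇(−½⟪Qy, y⟫) = −Qy`. -/
theorem hasGradientAt_quadForm (Q : ℝ³ →L[ℝ] ℝ³) (hQ : ∀ x y : ℝ³, ⟪Q x, y⟫ = ⟪x, Q y⟫) (y : ℝ³) :
    HasGradientAt (fun z : ℝ³ => -(1 / 2 : ℝ) * ⟪Q z, z⟫) (-(Q y)) y := by
  have h1 : HasFDerivAt (fun z : ℝ³ => Q z) Q y := Q.hasFDerivAt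
  have h2 : HasFDerivAt (fun z : ℝ³ => z) (ContinuousLinearMap.id ℝ ℝ³) y := hasFDerivAt_id y
  have h3 := (h1.inner (𝕜 := ℝ) h2).const_mul (-(1 / 2 : ℝ))
  rw [hasGradientAt_iff_hasFDerivAt]
  refine h3.congr_fderiv ?_
  ext h
  simp only [smul_apply, ContinuousLinearMap.comp_apply,
    ContinuousLinearMap.prod_apply, fderivInnerCLM_apply, ContinuousLinearMap.id_apply, smul_eq_mul,
    InnerProductSpace.toDual_apply_apply]
  rw [hQ h y, real_inner_comm (Q y) h, inner_neg_left]
  ring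

/-- `∇P = −Q y` for the pressure profile. -/
theorem hasGradientAt_linP (μ b : ℝ) (y : ℝ³) : HasGradientAt (linP μ b) (-(linQ μ b y)) y :=
  hasGradientAt_quadForm (linQ μ b) (linQ_symm μ b) y

/-- `gradient (linP μ b) y = −linQ μ b y`. -/
theorem gradient_linP (μ b : ℝ) (y : ℝ³) : gradient (linP μ b) y = -(linQ μ b y) :=
  (hasGradientAt_linP μ b y).gradient

/-- The pressure profile is smooth. -/
theorem contDiff_linP (μ b : ℝ) {n : WithTop ℕ∞} : ContDiff ℝ n (linP μ b) :=
  contDiff_const.mul ((linQ μ b).contDiff.inner (𝕜 := ℝ) contDiff_id)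

/-- A linear map is harmonic. -/
theorem laplacian_linA (μ b : ℝ) (y : ℝ³) : (Δ (⇑(linA μ b) : ℝ³ → ℝ³)) y = 0 := by
  rw [InnerProductSpace.laplacian_eq_iteratedFDeriv_stdOrthonormalBasis]
  refine Finset.sum_eq_zero fun i _ => ?_
  rw [iteratedFDeriv_two_apply]
  have h : fderiv ℝ (⇑(linA μ b)) = fun _ => linA μ b := by
    funext z
    exact (linA μ b).fderiv
  rw [h, fderiv_const_apply]
  rfl

/-- The convective + similarity terms: `½Ay + ½Ay + A(Ay) = Qy` up to the off-diagonal defect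
`b(1 − 2μ)`. -/
theorem linA_profile_coord (μ b : ℝ) (y : ℝ³) :
    ((1 / 2 : ℝ) • linA μ b y + (1 / 2 : ℝ) • linA μ b y + linA μ b (linA μ b y) - linQ μ b y) 0 =
        b * (1 - 2 * μ) * y 1 ∧
      ((1 / 2 : ℝ) • linA μ b y + (1 / 2 : ℝ) • linA μ b y + linA μ b (linA μ b y) - linQ μ b y) 1 =
        -(b * (1 - 2 * μ)) * y 0 ∧
      ((1 / 2 : ℝ) • linA μ b y + (1 / 2 : ℝ) • linA μ b y + linA μ b (linA μ b y) - linQ μ b y) 2 = 0 := by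
  refine ⟨?_, ?_, ?_⟩
  · simp only [PiLp.sub_apply, PiLp.add_apply, PiLp.smul_apply, smul_eq_mul, linA_fst, linA_snd,
      linQ_fst]
    ring
  · simp only [PiLp.sub_apply, PiLp.add_apply, PiLp.smul_apply, smul_eq_mul, linA_fst, linA_snd,
      linQ_snd]
    ring
  · simp only [PiLp.sub_apply, PiLp.add_apply, PiLp.smul_apply, smul_eq_mul, linA_thd, linQ_thd]
    ring

/-- **Linear Leray profiles.** For every viscosity `ν` and all `μ, b` with `b(1 − 2μ) = 0`,
`(linA μ b, linP μ b)` solves Leray's backward profile system with rate `a = ½`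
(`−νΔU + ½U + ½(y·∇)U + (U·∇)U + ∇P = 0`, `div U = 0`).  Two families: the pure strains
`b = 0` (any `μ`: `U = diag(−μ,−μ,2μ)y`, irrotational) and the stretched similarity column
`μ = ½` (any swirl `b`: vorticity `−2b e₂`, stationary in similarity variables). -/
theorem isLerayProfile_linA (ν μ b : ℝ) (h : b * (1 - 2 * μ) = 0) :
    IsLerayProfile ν (1 / 2) (⇑(linA μ b)) (linP μ b) where
  contDiff_velocity := (linA μ b).contDiff
  contDiff_pressure := contDiff_linP μ b
  profile_eq y := by
    have hc := linA_profile_coord μ b y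
    rw [laplacian_linA, smul_zero, neg_zero, zero_add, convect_apply, (linA μ b).fderiv,
      gradient_linP, ← sub_eq_add_neg]
    ext i
    fin_cases i
    · simp only [Fin.zero_eta, Fin.isValue, PiLp.zero_apply]
      rw [hc.1, h, zero_mul]
    · simp only [Fin.mk_one, Fin.isValue, PiLp.zero_apply]
      rw [hc.2.1, h, neg_zero, zero_mul]
    · simp only [Fin.reduceFinMk, Fin.isValue, PiLp.zero_apply]
      rw [hc.2.2]
  divFree := linA_divFree μ b

/-- The pure-strain profiles (any `μ`). -/
theorem isLerayProfile_strain (ν μ : ℝ) : IsLerayProfile ν (1 / 2) (⇑(linA μ 0)) (linP μ 0) :=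
  isLerayProfile_linA ν μ 0 (by ring)

/-- The stretched similarity column (any swirl `b`). -/
theorem isLerayProfile_column (ν b : ℝ) : IsLerayProfile ν (1 / 2) (⇑(linA (1 / 2) b)) (linP (1 / 2) b) :=
  isLerayProfile_linA ν (1 / 2) b (by ring)

/-- On the column the vortex stretching balances Leray's damping exactly: `(Ω·∇)U = U'Ω = Ω`
for `Ω = curl U = −2b e₂` — so `Ω` is a STEADY state of the similarity vorticity equation
`∂ₛΩ + Ω + ½(y·∇)Ω + (U·∇)Ω = (Ω·∇)U + ΔΩ` (all other terms vanish for constant `Ω`). -/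
theorem column_stretching_balance (b : ℝ) (y : ℝ³) :
    linA (1 / 2) b (curl (⇑(linA (1 / 2) b)) y) = curl (⇑(linA (1 / 2) b)) y := by
  rw [curl_linA, map_smul, linA_e2]
  norm_num

/-! ### The physical field: Leray's ansatz, squeezed at any level, outside the class -/

/-- The physical velocity `lin μ b t x = (−t)⁻¹ · linA μ b x`. -/
def lin (μ b : ℝ) (t : ℝ) (x : ℝ³) : ℝ³ := (-t)⁻¹ • linA μ b x

/-- It is Leray's backward self-similar ansatz (rate `a = ½`, blow-up time `T = 0`) on the
profile `linA μ b`: `u(t, x) = (−t)^{−1/2} U(x/√(−t))` for `t < 0`. -/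
theorem lin_eq_lerayBackward (μ b : ℝ) {t : ℝ} (ht : t < 0) (x : ℝ³) :
    lin μ b t x = lerayBackward (1 / 2) 0 (⇑(linA μ b)) t x := by
  rw [lerayBackward_apply, map_smul, smul_smul, lin]
  congr 1
  have h : (2 : ℝ) * (1 / 2) * (0 - t) = -t := by ring
  rw [h, ← mul_inv, Real.mul_self_sqrt (by linarith : (0 : ℝ) ≤ -t)]

/-- Its similarity orbit is the steady profile: `lerayOrbit (lin μ b) s = linA μ b` for all `s`. -/
theorem lerayOrbit_lin (μ b s : ℝ) (y : ℝ³) : lerayOrbit (lin μ b) s y = linA μ b y := by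
  rw [lerayOrbit_apply, lin, neg_neg, map_smul, smul_smul, smul_smul]
  have h : Real.exp (-s / 2) * (Real.exp (-s))⁻¹ * Real.exp (-s / 2) = 1 := by
    rw [← Real.exp_neg, neg_neg, ← Real.exp_add, ← Real.exp_add]
    convert Real.exp_zero using 2
    ring
  rw [h, one_smul]

/-- Hence its similarity vorticity is the constant `−2b e₂` at every `s` (nonzero for `b ≠ 0`:
`Z_R(s) = 4b²∫φ_R` is a nonzero constant — no backward decay whatsoever). -/
theorem lerayVorticity_lin (μ b s : ℝ) (y : ℝ³) : lerayVorticity (lin μ b) s y = (-2 * b) • e2 := by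
  have h : lerayOrbit (lin μ b) s = ⇑(linA μ b) := funext (lerayOrbit_lin μ b s)
  rw [lerayVorticity_apply, h, curl_linA]

/-- Space derivative of the physical field: `∇u(t) = (−t)⁻¹ linA μ b`. -/
theorem hasFDerivAt_lin (μ b t : ℝ) (x : ℝ³) : HasFDerivAt (lin μ b t) ((-t)⁻¹ • linA μ b) x := by
  change HasFDerivAt (fun x : ℝ³ => (-t)⁻¹ • linA μ b x) ((-t)⁻¹ • linA μ b) x
  exact ((linA μ b).hasFDerivAt).const_smul ((-t)⁻¹)

/-- `fderiv` form of `hasFDerivAt_lin`. -/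
theorem fderiv_lin (μ b t : ℝ) (x : ℝ³) : fderiv ℝ (lin μ b t) x = (-t)⁻¹ • linA μ b :=
  (hasFDerivAt_lin μ b t x).fderiv

/-- H1: smooth on `t < 0`. -/
theorem lin_h1 (μ b : ℝ) : H1 (lin μ b) := by
  have h1 : ContDiffOn ℝ (⊤ : ℕ∞) (fun p : ℝ × ℝ³ => (-p.1)⁻¹) (Set.Iio 0 ×ˢ Set.univ) := by
    refine contDiffOn_fst.neg.inv ?_
    rintro ⟨t, x⟩ ⟨ht, -⟩
    simp only [Set.mem_Iio] at ht
    simp only [ne_eq, neg_eq_zero]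
    exact ht.ne
  have h2 : ContDiffOn ℝ (⊤ : ℕ∞) (fun p : ℝ × ℝ³ => linA μ b p.2) (Set.Iio 0 ×ˢ Set.univ) :=
    ((linA μ b).contDiff.comp contDiff_snd).contDiffOn
  have h3 : Function.uncurry (lin μ b) = fun p : ℝ × ℝ³ => (-p.1)⁻¹ • linA μ b p.2 := rfl
  rw [H1, h3]
  exact h1.smul h2

/-- H2: divergence free on `t < 0`. -/
theorem lin_h2 (μ b : ℝ) : H2 (lin μ b) := by
  intro t _ x
  have h0 := linA_divFree μ b x
  rw [divergence_eq_sum_inner_fderiv (EuclideanSpace.basisFun (Fin 3) ℝ), (linA μ b).fderiv] at h0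
  rw [divergence_eq_sum_inner_fderiv (EuclideanSpace.basisFun (Fin 3) ℝ), fderiv_lin]
  simp only [smul_apply, real_inner_smul_right]
  rw [← Finset.mul_sum, h0, mul_zero]

/-- **H6 at ANY level `a ≥ −μ`.** The Leray-gauge form `(−t)⟪∇u ξ, ξ⟫ = ⟪linA ξ, ξ⟫ = −μ|ξ|²` on
the plane `e₀, e₁`: the flow is squeezed with `Λ ≤ −μ`, as negative as desired. -/
theorem lin_h6 (μ b : ℝ) {a : ℝ} (ha : -μ ≤ a) : H6 a (lin μ b) := by
  intro t ht x
  refine ⟨e0, e1, by simp [e0], by simp [e1], by simp [e0, e1, EuclideanSpace.inner_single_left],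
    fun α β => ?_⟩
  rw [fderiv_lin, smul_apply, real_inner_smul_left, inner_linA_plane]
  have ht' : (-t) * (-t)⁻¹ = 1 := mul_inv_cancel₀ (by linarith)
  calc -t * ((-t)⁻¹ * (-μ * (α ^ 2 + β ^ 2))) = (-t) * (-t)⁻¹ * (-μ * (α ^ 2 + β ^ 2)) := by ring
    _ = -μ * (α ^ 2 + β ^ 2) := by rw [ht', one_mul]
    _ ≤ a * (α ^ 2 + β ^ 2) := by nlinarith [sq_nonneg α, sq_nonneg β]

/-- `‖e₂‖ = 1`. -/
theorem norm_e2 : ‖e2‖ = 1 := by simp [e2]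

/-- **Not Type-I bounded** (H4 fails for every constant, unless `μ = 0`): along the axis
`‖u(−1, r e₂)‖ = 2|μ| r` is unbounded.  (H5 fails as well, and so does the typed Oseen clause
H3 — the flow is pressure-driven from infinity; it is in no `𝒦_C`.) -/
theorem lin_not_h4 (μ b C : ℝ) (hμ : μ ≠ 0) : ¬ H4 C (lin μ b) := by
  intro h
  have hμ' : 0 < |μ| := abs_pos.2 hμ
  set r : ℝ := (|C| + 1) / (2 * |μ|) with hr
  have hr0 : 0 ≤ r := by positivity
  have h1 := h (-1) (by norm_num) (r • e2)
  have hval : lin μ b (-1) (r • e2) = (r * (2 * μ)) • e2 := by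
    rw [lin, map_smul, linA_e2, smul_smul, smul_smul]
    norm_num
  rw [hval, norm_smul, norm_e2, mul_one, Real.norm_eq_abs, abs_mul, abs_of_nonneg hr0, abs_mul,
    abs_two] at h1
  norm_num at h1
  have h2 : r * (2 * |μ|) = |C| + 1 := by
    rw [hr]
    field_simp
  have h3 : |C| + 1 ≤ C := by
    calc |C| + 1 = r * (2 * |μ|) := h2.symm
      _ ≤ C := h1
  linarith [le_abs_self C]

/-! ### The self-similar shadow of the crux has no content without normalisation -/

/-- "Every Leray profile (`ν = 1`, `a = ½`) whose strain is squeezed below `a` on some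
orthonormal 2-frame at every point vanishes identically" — `MustSqueezeAt a` restricted to the
self-similar sector with the normalisation H4–H5 (and the Oseen gauge H3) removed. -/
def MustSqueezeProfiles (a : ℝ) : Prop :=
  ∀ (U : ℝ³ → ℝ³) (P : ℝ³ → ℝ), IsLerayProfile 1 (1 / 2) U P →
    (∀ y, ∃ v w : ℝ³, ‖v‖ = 1 ∧ ‖w‖ = 1 ∧ ⟪v, w⟫ = 0 ∧
      ∀ α β : ℝ, ⟪fderiv ℝ U y (α • v + β • w), α • v + β • w⟫ ≤ a * (α ^ 2 + β ^ 2)) →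
    ∀ y, U y = 0

/-- **False at every threshold.** The pure strain `linA μ 0` with `μ = max 1 (−a)` is a nonzero
Leray profile squeezed below `−μ ≤ a`.  So in the self-similar sector the squeeze hypothesis is
void by itself: NRŠ 1996 / Tsai 1998 exclude profiles through `L³` / local-energy hypotheses
(our H4–H5), for every value of `Λ`; any proof of the crux must spend H4 ∧ H5 (cf.
`mustSqueeze_false_without_H4H5`, which needed `a ≥ 0`; here `a` is arbitrary). -/
theorem not_mustSqueezeProfiles (a : ℝ) : ¬ MustSqueezeProfiles a := by
  intro h
  set μ : ℝ := max 1 (-a) with hμ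
  have hμ1 : 1 ≤ μ := le_max_left _ _
  have hμa : -μ ≤ a := by
    have : -a ≤ μ := le_max_right _ _
    linarith
  have key := h (⇑(linA μ 0)) (linP μ 0) (isLerayProfile_strain 1 μ) (fun y =>
    ⟨e0, e1, by simp [e0], by simp [e1], by simp [e0, e1, EuclideanSpace.inner_single_left],
      fun α β => by
        rw [(linA μ 0).fderiv, inner_linA_plane]
        nlinarith [sq_nonneg α, sq_nonneg β]⟩) e2
  rw [linA_e2] at key
  have h2 : ‖(2 * μ) • e2‖ = 2 * μ := by
    rw [norm_smul, norm_e2, mul_one, Real.norm_eq_abs, abs_of_nonneg (by linarith)]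
  rw [key, norm_zero] at h2
  linarith

end Summit.NavierStokesRegularity.NavierStokesRegularity.Theorems.MustSqueeze.Negative

end
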